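import Literature.NumberTheory.Automorphic.ArchKirillovODEGL2Complex
import Literature.NumberTheory.Automorphic.ArchKirillovBesselGL2Real
import HarnessLib

/-!
# The Kirillov function of a highest `SU(2)`-weight vector of `GL₂(K_∞)` along a complex place:
# the antiholomorphic Casimir equation and its `K`-Bessel solution (Jacquet–Langlands (1970), §6)

Topic `NumberTheory/Automorphic`; namespace `Literature.NumberTheory.Automorphic`. Theorems only (no
definition, no named fact, no instance). This generalises `ArchKirillovODEGL2Complex` /
`ArchKirillovBesselGL2Complex` from `SU(2)_w`-SPHERICAL vectors to the highest-weight vector of an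
ARBITRARY `SU(2)_w`-type, which is what a generic irreducible unitary representation of `GL₂(ℂ)` without
a spherical vector (`π(χ₁, χ₂)` with `χ₁χ₂⁻¹` non-trivial on `U(1)`) requires. Fix a complex place `w`
(`c = c_w`, `H = E₀₀ ⊗ c`) and write `τ^a(E_{ij}) = τ(E_{ij} ⊗ c) + i τ(E_{ij} ⊗ ic)` for the
ANTIholomorphic letters (`ArchPlaceCasimirComplex.archDerivAnti`) next to the holomorphic
`τ^h(E_{ij}) = τ(E_{ij} ⊗ c) - i τ(E_{ij} ⊗ ic)`; the two families commute and each satisfies the `𝔤𝔩₂`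
relations with doubled brackets (`gardingEndAnti_xPlus_comm_xMinus`). The complexified `𝔲(2)` acts by
`Y ↦ τ^h(Y) - τ^a(Yᵀ)`, so a vector `v ∈ 𝒢` of HIGHEST weight `m` in its `SU(2)_w`-type satisfies

  `(R)`  `τ^h(E₀₁) v = τ^a(E₁₀) v`       (`τ((E₀₁ - E₁₀) ⊗ c) v - i τ((E₀₁ + E₁₀) ⊗ ic) v = 0`),
  `(T)`  `τ((E₀₀ - E₁₁) ⊗ ic) v = i m v`.

* `placeCasimirAnti_apply_of_highest` — for such `v` with `τ^a(E₀₀) v + τ^a(E₁₁) v = z v`: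
  `C^a v = 2 τ^a(E₀₀)² v - (2z + 4) τ^a(E₀₀) v + (z² + 2z) v + 2 τ^a(E₀₁) τ^h(E₀₁) v` — the point being
  that `τ^a(E₁₀)` is eliminated through `(R)` and the bracket, and BOTH `τ^a(E₀₁)`, `τ^h(E₀₁)` are
  multiplications by `e^y θ^a`, `e^y θ^h` in the Kirillov model, so the equation closes on the single
  scalar function `f(y) = ℓ(τ(exp yH) v)`;
* `kirillovODE_complex_highest` — with central characters `μ₁, μ₂` (`τ(1 ⊗ c) v = μ₁ v`,
  `τ(1 ⊗ ic) v = μ₂ v`) and antiholomorphic Casimir eigenvalue `λ` (`C^a v = λ v`, which holds on the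
  Gårding space of an irreducible unitary `τ`, `ArchPlaceCasimirScalar.exists_placeCasimirAnti_eq_smul`):

    `2 f₂ - (2μ₁ + 2m + 4) f₁ + (μ₁² + iμ₁μ₂ - μ₂²/2 + 2μ₁ + m²/2 + μ₁ m + 2m - λ) f + 2 θ^aθ^h e^{2y} f = 0`,

  the weight-zero real equation with `μ = μ₁ + m + 1` and `θ² = θ^aθ^h = -a²`;
* `exists_apply_gardingAct_expGLC_eq_besselMode_of_highest` — hence, for `τ` acting by contractions and
  `ℓ` continuous for the `U(𝔤)`-seminorms, `ℓ(τ(exp yH) v) = c e^{(μ₁+m+1)y/2} besselMode a ν (e^y)` with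
  `λ = (μ₁ + iμ₂)²/2 - 2ν² - 2` (the `SU(2)`-weight `m` only shifts the power: Jacquet–Langlands (1970),
  §6, the Whittaker functions of `π(χ₁, χ₂)` in the `K`-type `ρ_m` are `|t|^{(m+1)/2 + …} K_ν(4π|t|)`),
  and `…_and_mellin`: `∫₀^∞ f(log u) u^{S-1/2} du/u = 2c a^{-(S+μ/2)} 2^{S+μ/2-2} Γ(½(S+μ/2+iν)) Γ(½(S+μ/2-iν))`,
  `μ = μ₁ + m + 1`.

## References

* H. Jacquet, R. P. Langlands, *Automorphic Forms on GL(2)*, LNM 114 (1970), §6 (PDF pp. 130–150 of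
  the held retypeset copy). [JacquetLanglands1970]
* A. W. Knapp, *Representation Theory of Semisimple Groups*, Princeton 1986, Ch. VIII §3. [Knapp1986]
-/

noncomputable section

open MeasureTheory Measure NumberField NumberField.InfinitePlace NumberField.mixedEmbedding IsDedekindDomain Set Filter
open scoped MatrixGroups Topology Classical

namespace Literature.NumberTheory.Automorphic

variable {K : Type} [Field K] [NumberField K]

-- as in `ArchGardingWhittaker`
set_option backward.isDefEq.respectTransparency false

/-! ### 1. Antiholomorphic letters in `End(𝒢)` -/

section EndIdentities

variable {hcpt : isCompact_glFiniteIntegralLevel 2 K}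
  {E : Type*} [NormedAddCommGroup E] [NormedSpace ℂ E] [CompleteSpace E]
  {τ : ContRepresentation ℂ (AutomorphyDatum.gl 2 K hcpt).arch.carrier E}
  (hτ : τ.IsStronglyContinuous) (w : {w : InfinitePlace K // IsComplex w})

local notation "𝐜" => ((0, Pi.single w 1) : mixedSpace K)
local notation "𝐜I" => ((0, Pi.single w Complex.I) : mixedSpace K)
local notation "Hc" => Matrix.single (0 : Fin 2) (0 : Fin 2) ((0, Pi.single w 1) : mixedSpace K)
local notation "D" => gardingEnd (hcpt := hcpt) (τ := τ) hτ
local notation "A[" y "]" => gardingAct (hcpt := hcpt) (τ := τ) hτ (expGL ((y : ℝ) • Hc))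
local notation "Dh[" i "," j "]" => (gardingEnd (hcpt := hcpt) (τ := τ) hτ (Matrix.single (i : Fin 2) (j : Fin 2) ((0, Pi.single w 1) : mixedSpace K)) -
  Complex.I • gardingEnd (hcpt := hcpt) (τ := τ) hτ (Matrix.single (i : Fin 2) (j : Fin 2) ((0, Pi.single w Complex.I) : mixedSpace K)))
local notation "Da[" i "," j "]" => (gardingEnd (hcpt := hcpt) (τ := τ) hτ (Matrix.single (i : Fin 2) (j : Fin 2) ((0, Pi.single w 1) : mixedSpace K)) +
  Complex.I • gardingEnd (hcpt := hcpt) (τ := τ) hτ (Matrix.single (i : Fin 2) (j : Fin 2) ((0, Pi.single w Complex.I) : mixedSpace K)))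

/-- The antiholomorphic letter in `End(𝒢)`-form agrees with the tree's `archDerivAnti`. [folklore] -/
theorem coe_gardingEndAnti_apply (i j : Fin 2) (v : archGardingSpace hcpt τ) :
    ((Da[i,j] v : archGardingSpace hcpt τ) : E) = archDerivAnti hcpt τ w i j v := by
  simp [archDerivAnti]

/-- The antiholomorphic Casimir in `End(𝒢)`-form equals the tree's `Σ archDerivAnti (archDerivAnti ·)`. [folklore] -/
theorem coe_placeCasimirAnti_apply (v : archGardingSpace hcpt τ) :
    ((∑ i : Fin 2, ∑ j : Fin 2, Da[i,j] (Da[j,i] v) : archGardingSpace hcpt τ) : E) =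
      ∑ i : Fin 2, ∑ j : Fin 2, archDerivAnti hcpt τ w i j (archDerivAnti hcpt τ w j i v) := by
  rw [Submodule.coe_sum]
  refine Finset.sum_congr rfl fun i _ => ?_
  rw [Submodule.coe_sum]
  refine Finset.sum_congr rfl fun j _ => ?_
  rw [coe_gardingEndAnti_apply, coe_gardingEndAnti_apply]

/-- **The bracket `[τ^a(E₀₁), τ^a(E₁₀)] = 2 (τ^a(E₀₀) - τ^a(E₁₁))`** (the antiholomorphic letters satisfy
the `𝔤𝔩₂` relations with doubled brackets, as the holomorphic ones). [cite: Knapp1986, Ch. VIII §3] -/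
theorem gardingEndAnti_xPlus_comm_xMinus :
    Da[0,1] * Da[1,0] - Da[1,0] * Da[0,1] = (2 : ℂ) • (Da[0,0] - Da[1,1]) := by
  have b1 : D (Matrix.single 0 1 𝐜) * D (Matrix.single 1 0 𝐜) =
      D (Matrix.single 1 0 𝐜) * D (Matrix.single 0 1 𝐜) + (D (Matrix.single 0 0 𝐜) - D (Matrix.single 1 1 𝐜)) := by
    rw [gardingEnd_mul_eq hτ, Matrix.single_mul_single_same, Matrix.single_mul_single_same, complexIdem_mul_self,
      gardingEnd_sub]
  have b2 : D (Matrix.single 0 1 𝐜) * D (Matrix.single 1 0 𝐜I) =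
      D (Matrix.single 1 0 𝐜I) * D (Matrix.single 0 1 𝐜) + (D (Matrix.single 0 0 𝐜I) - D (Matrix.single 1 1 𝐜I)) := by
    rw [gardingEnd_mul_eq hτ, Matrix.single_mul_single_same, Matrix.single_mul_single_same,
      complexIdem_mul_complexIdemI, complexIdemI_mul_complexIdem, gardingEnd_sub]
  have b3 : D (Matrix.single 0 1 𝐜I) * D (Matrix.single 1 0 𝐜) =
      D (Matrix.single 1 0 𝐜) * D (Matrix.single 0 1 𝐜I) + (D (Matrix.single 0 0 𝐜I) - D (Matrix.single 1 1 𝐜I)) := by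
    rw [gardingEnd_mul_eq hτ, Matrix.single_mul_single_same, Matrix.single_mul_single_same,
      complexIdem_mul_complexIdemI, complexIdemI_mul_complexIdem, gardingEnd_sub]
  have b4 : D (Matrix.single 0 1 𝐜I) * D (Matrix.single 1 0 𝐜I) =
      D (Matrix.single 1 0 𝐜I) * D (Matrix.single 0 1 𝐜I) + (-1 : ℂ) • (D (Matrix.single 0 0 𝐜) - D (Matrix.single 1 1 𝐜)) := by
    rw [gardingEnd_mul_eq hτ, Matrix.single_mul_single_same, Matrix.single_mul_single_same, complexIdemI_mul_self,
      show -𝐜 = (-1 : ℝ) • 𝐜 from (neg_one_smul ℝ _).symm, ← Matrix.smul_single, ← Matrix.smul_single, ← smul_sub,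
      gardingEnd_smul, gardingEnd_sub, Complex.ofReal_neg, Complex.ofReal_one]
  simp only [add_mul, mul_add, smul_mul_assoc, mul_smul_comm, b1, b2, b3, b4, smul_add, smul_sub, smul_smul]
  match_scalars <;> first | ring1 | linear_combination (-1 : ℂ) * Complex.I_sq | linear_combination Complex.I_sq

/-- `τ^a(E₁₁) τ^a(E₀₀) = τ^a(E₀₀) τ^a(E₁₁)`. [folklore] -/
theorem gardingEndAnti_hOne_mul_hZero : Da[1,1] * Da[0,0] = Da[0,0] * Da[1,1] := by
  have b : ∀ x x' : mixedSpace K, D (Matrix.single 1 1 x) * D (Matrix.single 0 0 x') =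
      D (Matrix.single 0 0 x') * D (Matrix.single 1 1 x) := fun x x' => by
    rw [gardingEnd_mul_eq hτ, Matrix.single_mul_single_of_ne (h := (by decide : (1 : Fin 2) ≠ 0)),
      Matrix.single_mul_single_of_ne (h := (by decide : (0 : Fin 2) ≠ 1)), sub_zero, gardingEnd_zero, add_zero]
  simp only [add_mul, mul_add, smul_mul_assoc, mul_smul_comm, smul_add, smul_smul, b]
  abel

/-- **The antiholomorphic Casimir identity for a highest-weight vector.** If `τ^a(E₀₀) v + τ^a(E₁₁) v = z v`
and `τ^a(E₁₀) v = τ^h(E₀₁) v` (the vector is killed by the `SU(2)`-raising operator), then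
`C^a v = 2 τ^a(E₀₀)² v - (2z + 4) τ^a(E₀₀) v + (z² + 2z) v + 2 τ^a(E₀₁) τ^h(E₀₁) v`. [cite: Knapp1986, Ch. VIII §3] -/
theorem placeCasimirAnti_apply_of_highest (z : ℂ) (v : archGardingSpace hcpt τ)
    (hZ : Da[0,0] v + Da[1,1] v = z • v) (hM : Da[1,0] v = Dh[0,1] v) :
    ∑ i : Fin 2, ∑ j : Fin 2, Da[i,j] (Da[j,i] v) =
      (2 : ℂ) • Da[0,0] (Da[0,0] v) - (2 * z + 4) • Da[0,0] v + (z ^ 2 + 2 * z) • v +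
        (2 : ℂ) • Da[0,1] (Dh[0,1] v) := by
  have hop : Da[0,1] * Da[1,0] - Da[1,0] * Da[0,1] = (2 : ℂ) • (Da[0,0] - Da[1,1]) :=
    gardingEndAnti_xPlus_comm_xMinus hτ w
  have hcomm : Da[1,1] * Da[0,0] = Da[0,0] * Da[1,1] := gardingEndAnti_hOne_mul_hZero hτ w
  rw [Fin.sum_univ_two, Fin.sum_univ_two, Fin.sum_univ_two]
  -- treat the letters as atoms
  set A0 : Module.End ℂ (archGardingSpace hcpt τ) := Da[0,0] with hA0d
  set A1 : Module.End ℂ (archGardingSpace hcpt τ) := Da[1,1] with hA1d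
  set P : Module.End ℂ (archGardingSpace hcpt τ) := Da[0,1] with hPd
  set M : Module.End ℂ (archGardingSpace hcpt τ) := Da[1,0] with hMd
  set Ph : Module.End ℂ (archGardingSpace hcpt τ) := Dh[0,1] with hPhd
  have hA1 : A1 v = z • v - A0 v := by rw [← hZ]; abel
  have hc : A1 (A0 v) = A0 (A1 v) := by
    have h := congrArg (fun T => T v) hcomm
    simpa only [Module.End.mul_apply] using h
  have hA1sq : A1 (A1 v) = (z ^ 2) • v - (2 * z) • A0 v + A0 (A0 v) := by
    conv_lhs => rw [hA1]
    rw [map_sub, map_smul, hA1, hc, hA1, map_sub, map_smul, smul_sub, pow_two, mul_smul, two_mul, add_smul]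
    abel
  have hmp : M (P v) = P (M v) - (2 : ℂ) • (A0 v - A1 v) := by
    have h := congrArg (fun T => T v) hop
    simp only [LinearMap.sub_apply, Module.End.mul_apply, LinearMap.smul_apply] at h
    rw [← h]; abel
  rw [hmp, hM, hA1sq, hA1]
  module

end EndIdentities

/-! ### 2. The differential equation -/

section ODE

variable {hcpt : isCompact_glFiniteIntegralLevel 2 K}
  {E : Type*} [NormedAddCommGroup E] [NormedSpace ℂ E] [CompleteSpace E]
  {τ : ContRepresentation ℂ (AutomorphyDatum.gl 2 K hcpt).arch.carrier E}
  (hτ : τ.IsStronglyContinuous) (w : {w : InfinitePlace K // IsComplex w})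

local notation "𝐜" => ((0, Pi.single w 1) : mixedSpace K)
local notation "𝐜I" => ((0, Pi.single w Complex.I) : mixedSpace K)
local notation "Hc" => Matrix.single (0 : Fin 2) (0 : Fin 2) ((0, Pi.single w 1) : mixedSpace K)
local notation "D" => gardingEnd (hcpt := hcpt) (τ := τ) hτ
local notation "A[" y "]" => gardingAct (hcpt := hcpt) (τ := τ) hτ (expGL ((y : ℝ) • Hc))
local notation "Dh[" i "," j "]" => (gardingEnd (hcpt := hcpt) (τ := τ) hτ (Matrix.single (i : Fin 2) (j : Fin 2) ((0, Pi.single w 1) : mixedSpace K)) -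
  Complex.I • gardingEnd (hcpt := hcpt) (τ := τ) hτ (Matrix.single (i : Fin 2) (j : Fin 2) ((0, Pi.single w Complex.I) : mixedSpace K)))
local notation "Da[" i "," j "]" => (gardingEnd (hcpt := hcpt) (τ := τ) hτ (Matrix.single (i : Fin 2) (j : Fin 2) ((0, Pi.single w 1) : mixedSpace K)) +
  Complex.I • gardingEnd (hcpt := hcpt) (τ := τ) hτ (Matrix.single (i : Fin 2) (j : Fin 2) ((0, Pi.single w Complex.I) : mixedSpace K)))

/-- **The highest-weight conversions.** If `τ((E₀₀ - E₁₁) ⊗ ic) v = i m v` (torus weight `m`),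
`τ(1 ⊗ ic) v = μ₂ v` and `τ((E₀₁ - E₁₀) ⊗ c) v - i τ((E₀₁ + E₁₀) ⊗ ic) v = 0` (killed by the
`SU(2)`-raising operator), then `τ(E₀₀ ⊗ ic) v = ((μ₂ + im)/2) v` and `τ^a(E₁₀) v = τ^h(E₀₁) v`. [folklore] -/
theorem highest_conversions (μ₂ m : ℂ) (v : archGardingSpace hcpt τ)
    (hT : D (Matrix.single 0 0 𝐜I - Matrix.single 1 1 𝐜I) v = (Complex.I * m) • v)
    (hZ2 : D (Matrix.single 0 0 𝐜I + Matrix.single 1 1 𝐜I) v = μ₂ • v)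
    (hR : D (Matrix.single 0 1 𝐜 - Matrix.single 1 0 𝐜) v - Complex.I • D (Matrix.single 0 1 𝐜I + Matrix.single 1 0 𝐜I) v = 0) :
    D (Matrix.single 0 0 𝐜I) v = ((μ₂ + Complex.I * m) / 2) • v ∧ Da[1,0] v = Dh[0,1] v := by
  refine ⟨?_, ?_⟩
  · rw [gardingEnd_sub, LinearMap.sub_apply] at hT
    rw [gardingEnd_add, LinearMap.add_apply] at hZ2
    have h2 : (2 : ℂ) • D (Matrix.single 0 0 𝐜I) v = μ₂ • v + (Complex.I * m) • v := by
      rw [← hZ2, ← hT, two_smul]; abel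
    have h := congrArg (fun u => (2 : ℂ)⁻¹ • u) h2
    simp only [smul_smul, smul_add] at h
    rw [inv_mul_cancel₀ two_ne_zero, one_smul] at h
    rw [h, ← add_smul]
    congr 1
    ring
  · rw [gardingEnd_sub, gardingEnd_add, LinearMap.sub_apply, LinearMap.add_apply, smul_add] at hR
    rw [LinearMap.add_apply, LinearMap.sub_apply, LinearMap.smul_apply, LinearMap.smul_apply, ← sub_eq_zero]
    have e : D (Matrix.single 1 0 𝐜) v + Complex.I • D (Matrix.single 1 0 𝐜I) v -
        (D (Matrix.single 0 1 𝐜) v - Complex.I • D (Matrix.single 0 1 𝐜I) v) =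
        -(D (Matrix.single 0 1 𝐜) v - D (Matrix.single 1 0 𝐜) v -
          (Complex.I • D (Matrix.single 0 1 𝐜I) v + Complex.I • D (Matrix.single 1 0 𝐜I) v)) := by abel
    rw [e, hR, neg_zero]

/-- **The differential equation of the Kirillov function along a complex place for a highest-weight
vector of an `SU(2)_w`-type** (torus weight `m`, central characters `μ₁, μ₂`, antiholomorphic Casimir
eigenvalue `λ`):

  `2 f₂ - (2μ₁ + 2m + 4) f₁ + (μ₁² + iμ₁μ₂ - μ₂²/2 + 2μ₁ + m²/2 + μ₁m + 2m - λ) f + 2 (θ₁ + iθ₂)(θ₁ - iθ₂) e^{2y} f = 0`,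

`f = ℓ(τ(exp yH) v)`, `f₁ = f'`, `f₂ = f''` (`H = E₀₀ ⊗ c`); for `m = 0` and an `SU(2)`-spherical `v`
this is (the complex conjugate form of) `kirillovODE_complex`. Jacquet–Langlands (1970), §6; Knapp (1986),
Ch. VIII §3. [cite: JacquetLanglands1970, §6] [cite: Knapp1986, Ch. VIII §3] -/
theorem kirillovODE_complex_highest {ℓ : archGardingSpace hcpt τ →ₗ[ℂ] ℂ} {θ₁ θ₂ : ℂ}
    (hθ₁ : ∀ u : archGardingSpace hcpt τ, ℓ (D (Matrix.single 0 1 𝐜) u) = θ₁ * ℓ u)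
    (hθ₂ : ∀ u : archGardingSpace hcpt τ, ℓ (D (Matrix.single 0 1 𝐜I) u) = θ₂ * ℓ u)
    (μ₁ μ₂ m lam : ℂ) (v : archGardingSpace hcpt τ)
    (hR : D (Matrix.single 0 1 𝐜 - Matrix.single 1 0 𝐜) v - Complex.I • D (Matrix.single 0 1 𝐜I + Matrix.single 1 0 𝐜I) v = 0)
    (hT : D (Matrix.single 0 0 𝐜I - Matrix.single 1 1 𝐜I) v = (Complex.I * m) • v)
    (hZ1 : D (Matrix.single 0 0 𝐜 + Matrix.single 1 1 𝐜) v = μ₁ • v)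
    (hZ2 : D (Matrix.single 0 0 𝐜I + Matrix.single 1 1 𝐜I) v = μ₂ • v)
    (hC : ∑ i : Fin 2, ∑ j : Fin 2, Da[i,j] (Da[j,i] v) = lam • v) (y : ℝ) :
    2 * ℓ (A[y] (D Hc (D Hc v))) - (2 * μ₁ + 2 * m + 4) * ℓ (A[y] (D Hc v)) +
      (μ₁ ^ 2 + Complex.I * μ₁ * μ₂ - μ₂ ^ 2 / 2 + 2 * μ₁ + m ^ 2 / 2 + μ₁ * m + 2 * m - lam) * ℓ (A[y] v) +
        2 * ((θ₁ + Complex.I * θ₂) * (θ₁ - Complex.I * θ₂)) * (Real.exp y : ℂ) ^ 2 * ℓ (A[y] v) = 0 := by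
  obtain ⟨hQ, hM⟩ := highest_conversions hτ w μ₂ m v hT hZ2 hR
  -- `τ^a(E₀₀) v + τ^a(E₁₁) v = (μ₁ + iμ₂) v`
  have hZa : Da[0,0] v + Da[1,1] v = (μ₁ + Complex.I * μ₂) • v := by
    have h1 : D (Matrix.single 0 0 𝐜) v + D (Matrix.single 1 1 𝐜) v = μ₁ • v := by
      rwa [gardingEnd_add, LinearMap.add_apply] at hZ1
    have h2 : D (Matrix.single 0 0 𝐜I) v + D (Matrix.single 1 1 𝐜I) v = μ₂ • v := by
      rwa [gardingEnd_add, LinearMap.add_apply] at hZ2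
    simp only [LinearMap.add_apply, LinearMap.smul_apply]
    rw [add_smul, mul_smul, ← h1, ← h2, smul_add]
    abel
  have hcas := placeCasimirAnti_apply_of_highest hτ w (μ₁ + Complex.I * μ₂) v hZa hM
  rw [hC] at hcas
  obtain ⟨hh, ha⟩ := gardingAct_expGLC_mul_hol01 (hcpt := hcpt) (τ := τ) hτ w y
  -- `τ(E₀₀ ⊗ ic)` commutes with `τ(E₀₀ ⊗ c)`
  have hQc : D (Matrix.single 0 0 𝐜I) * D Hc = D Hc * D (Matrix.single 0 0 𝐜I) := by
    rw [gardingEnd_mul_eq hτ, Matrix.single_mul_single_same, Matrix.single_mul_single_same,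
      complexIdem_mul_complexIdemI, complexIdemI_mul_complexIdem, sub_self, gardingEnd_zero, add_zero]
  -- treat the letters as atoms
  set A0 : Module.End ℂ (archGardingSpace hcpt τ) := Da[0,0] with hA0d
  set P : Module.End ℂ (archGardingSpace hcpt τ) := Da[0,1] with hPd
  set Ph : Module.End ℂ (archGardingSpace hcpt τ) := Dh[0,1] with hPhd
  set q : ℂ := (μ₂ + Complex.I * m) / 2 with hq
  -- `τ^a(E₀₀) v = τ(H) v + iq v` and its square
  have hA0 : A0 v = D Hc v + (Complex.I * q) • v := by
    rw [hA0d, LinearMap.add_apply, LinearMap.smul_apply, hQ, smul_smul]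
  have hA0sq : A0 (A0 v) = D Hc (D Hc v) + (2 * (Complex.I * q)) • D Hc v + ((Complex.I * q) * (Complex.I * q)) • v := by
    have hQH : D (Matrix.single 0 0 𝐜I) (D Hc v) = q • D Hc v := by
      have h := congrArg (fun T => T v) hQc
      simp only [Module.End.mul_apply] at h
      rw [h, hQ, map_smul]
    have hstep : A0 (D Hc v) = D Hc (D Hc v) + (Complex.I * q) • D Hc v := by
      rw [hA0d, LinearMap.add_apply, LinearMap.smul_apply, hQH, smul_smul]
    conv_lhs => rw [hA0]
    rw [map_add, map_smul, hstep, hA0, smul_add, smul_smul]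
    module
  -- the `E₀₁`-terms: both `τ^a(E₀₁)` and `τ^h(E₀₁)` are multiplications in the Kirillov model
  have hPhℓ : ∀ x : archGardingSpace hcpt τ, ℓ (Ph x) = (θ₁ - Complex.I * θ₂) * ℓ x := fun x => by
    rw [hPhd, LinearMap.sub_apply, LinearMap.smul_apply, map_sub, map_smul, hθ₁, hθ₂, smul_eq_mul]; ring
  have hXh : ∀ u : archGardingSpace hcpt τ, ℓ (A[y] (Ph u)) = (Real.exp y : ℂ) * (θ₁ - Complex.I * θ₂) * ℓ (A[y] u) := by
    intro u
    have h1 := congrArg (fun T => ℓ (T u)) hh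
    simp only [Module.End.mul_apply, LinearMap.smul_apply, map_smul, smul_eq_mul] at h1
    rw [h1, hPhℓ]; ring
  have hPℓ : ∀ x : archGardingSpace hcpt τ, ℓ (P x) = (θ₁ + Complex.I * θ₂) * ℓ x := fun x => by
    rw [hPd, LinearMap.add_apply, LinearMap.smul_apply, map_add, map_smul, hθ₁, hθ₂, smul_eq_mul]; ring
  have hXa : ∀ u : archGardingSpace hcpt τ, ℓ (A[y] (P u)) = (Real.exp y : ℂ) * (θ₁ + Complex.I * θ₂) * ℓ (A[y] u) := by
    intro u
    have h1 := congrArg (fun T => ℓ (T u)) ha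
    simp only [Module.End.mul_apply, LinearMap.smul_apply, map_smul, smul_eq_mul] at h1
    rw [h1, hPℓ]; ring
  -- apply `ℓ ∘ τ(exp yH)` to the Casimir identity
  have h := congrArg (fun u : archGardingSpace hcpt τ => ℓ (A[y] u)) hcas
  have hA0' := congrArg (fun u : archGardingSpace hcpt τ => ℓ (A[y] u)) hA0
  have hA0sq' := congrArg (fun u : archGardingSpace hcpt τ => ℓ (A[y] u)) hA0sq
  simp only [map_add, map_sub, map_smul, smul_eq_mul] at h hA0' hA0sq'
  simp only [hXa, hXh, hA0', hA0sq'] at h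
  rw [hq] at h
  linear_combination -h + (-2 * m * ℓ (A[y] (D Hc v)) +
    (-(μ₂ ^ 2) / 2 + (1 - Complex.I ^ 2) * m ^ 2 / 2 + μ₁ * m + 2 * m) * ℓ (A[y] v)) * Complex.I_sq

end ODE

/-! ### 3. The `K`-Bessel solution and its Mellin transform -/

section Bessel

variable {hcpt : isCompact_glFiniteIntegralLevel 2 K}
  {E : Type*} [NormedAddCommGroup E] [NormedSpace ℂ E] [CompleteSpace E]
  {τ : ContRepresentation ℂ (AutomorphyDatum.gl 2 K hcpt).arch.carrier E}
  (hτ : τ.IsStronglyContinuous) (w : {w : InfinitePlace K // IsComplex w})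

local notation "𝐜" => ((0, Pi.single w 1) : mixedSpace K)
local notation "𝐜I" => ((0, Pi.single w Complex.I) : mixedSpace K)
local notation "Hc" => Matrix.single (0 : Fin 2) (0 : Fin 2) ((0, Pi.single w 1) : mixedSpace K)
local notation "D" => gardingEnd (hcpt := hcpt) (τ := τ) hτ
local notation "A[" y "]" => gardingAct (hcpt := hcpt) (τ := τ) hτ (expGL ((y : ℝ) • Hc))
local notation "Da[" i "," j "]" => (gardingEnd (hcpt := hcpt) (τ := τ) hτ (Matrix.single (i : Fin 2) (j : Fin 2) ((0, Pi.single w 1) : mixedSpace K)) +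
  Complex.I • gardingEnd (hcpt := hcpt) (τ := τ) hτ (Matrix.single (i : Fin 2) (j : Fin 2) ((0, Pi.single w Complex.I) : mixedSpace K)))

/-- **The Kirillov function of a highest `SU(2)_w`-weight Casimir eigenvector along a complex place is a
`K`-Bessel function**: with the hypotheses of `kirillovODE_complex_highest`, `τ` acting by contractions,
`ℓ` continuous for the `U(𝔤)`-seminorms, `(θ₁ + iθ₂)(θ₁ - iθ₂) = -a²` (`a > 0`) and
`λ = (μ₁ + iμ₂)²/2 - 2ν² - 2`, there is `c ∈ ℂ` with
`ℓ(τ(exp yH) v) = c e^{(μ₁+m+1)y/2} besselMode a ν (e^y)` for all `y`. [cite: JacquetLanglands1970, §6]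
[cite: Knapp1986, Ch. VIII §3] -/
theorem exists_apply_gardingAct_expGLC_eq_besselMode_of_highest (hτb : ∀ g, ‖(τ g : E →L[ℂ] E)‖ ≤ 1)
    {ℓ : archGardingSpace hcpt τ →ₗ[ℂ] ℂ}
    (hℓ : ∃ (C : ℝ) (𝒮 : Finset (List (Matrix (Fin 2) (Fin 2) (mixedSpace K)))), 0 ≤ C ∧
      ∀ v : archGardingSpace hcpt τ, ‖ℓ v‖ ≤ C * ∑ w ∈ 𝒮, ‖archWordDerivE hcpt τ w v‖)
    {θ₁ θ₂ : ℂ} (hθ₁ : ∀ u : archGardingSpace hcpt τ, ℓ (D (Matrix.single 0 1 𝐜) u) = θ₁ * ℓ u)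
    (hθ₂ : ∀ u : archGardingSpace hcpt τ, ℓ (D (Matrix.single 0 1 𝐜I) u) = θ₂ * ℓ u)
    {a : ℝ} (ha : 0 < a) (hθa : (θ₁ + Complex.I * θ₂) * (θ₁ - Complex.I * θ₂) = -((a : ℂ) ^ 2))
    (μ₁ μ₂ m lam ν : ℂ) (hlam : lam = (μ₁ + Complex.I * μ₂) ^ 2 / 2 - 2 * ν ^ 2 - 2) (v : archGardingSpace hcpt τ)
    (hR : D (Matrix.single 0 1 𝐜 - Matrix.single 1 0 𝐜) v - Complex.I • D (Matrix.single 0 1 𝐜I + Matrix.single 1 0 𝐜I) v = 0)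
    (hT : D (Matrix.single 0 0 𝐜I - Matrix.single 1 1 𝐜I) v = (Complex.I * m) • v)
    (hZ1 : D (Matrix.single 0 0 𝐜 + Matrix.single 1 1 𝐜) v = μ₁ • v)
    (hZ2 : D (Matrix.single 0 0 𝐜I + Matrix.single 1 1 𝐜I) v = μ₂ • v)
    (hC : ∑ i : Fin 2, ∑ j : Fin 2, Da[i,j] (Da[j,i] v) = lam • v) :
    ∃ c : ℂ, ∀ y : ℝ, ℓ (A[y] v) = c * (Real.exp y : ℂ) ^ ((μ₁ + m + 1) / 2) * besselMode a ν (Real.exp y) := by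
  -- the differential equation, rewritten with `θ = ia`
  have hIa : (Complex.I * a) ^ 2 = -((a : ℂ) ^ 2) := by rw [mul_pow, Complex.I_sq]; ring
  have hode : ∀ y : ℝ, 2 * ℓ (A[y] (D Hc (D Hc v))) - (2 * (μ₁ + m + 1) + 2) * ℓ (A[y] (D Hc v)) +
      (μ₁ ^ 2 + Complex.I * μ₁ * μ₂ - μ₂ ^ 2 / 2 + 2 * μ₁ + m ^ 2 / 2 + μ₁ * m + 2 * m - lam) * ℓ (A[y] v) +
        2 * (Complex.I * a) ^ 2 * (Real.exp y : ℂ) ^ 2 * ℓ (A[y] v) = 0 := fun y => by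
    have h := kirillovODE_complex_highest hτ w hθ₁ hθ₂ μ₁ μ₂ m lam v hR hT hZ1 hZ2 hC y
    rw [hθa] at h
    rw [hIa]
    linear_combination h
  -- derivatives
  have hf : ∀ y : ℝ, HasDerivAt (fun x : ℝ => ℓ (A[x] v)) (ℓ (A[y] (D Hc v))) y :=
    fun y => hasDerivAt_apply_gardingAct_expGLC hτ w hℓ v y
  have hf₁ : ∀ y : ℝ, HasDerivAt (fun x : ℝ => ℓ (A[x] (D Hc v))) (ℓ (A[y] (D Hc (D Hc v)))) y :=
    fun y => hasDerivAt_apply_gardingAct_expGLC hτ w hℓ (D Hc v) y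
  -- growth: `|ℓ(τ(exp yH) v)| ≤ M e^{2N|y|}` (`exp(yH) = 1 + (e^y - 1)H`, `exists_norm_apply_gardingAct_le`)
  obtain ⟨M, N, hM, hb⟩ := exists_norm_apply_gardingAct_le hτ hτb hℓ Hc v
  have hgrow' : ∀ y : ℝ, 0 ≤ y → ‖ℓ (A[y] v)‖ ≤ M * Real.exp (((2 * N : ℕ) : ℝ) * y) := fun y hy => by
    have h := hb (expGL (y • Hc)) (Real.exp (-y) - 1) (Real.exp y - 1) (coe_expGL_smul_hZeroC_inv w y)
      (coe_expGL_smul_hZeroC w y)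
    have key : (1 + |Real.exp (-y) - 1|) * (1 + |Real.exp y - 1|) ≤ Real.exp |y| ^ 2 := by
      have h1 := one_add_abs_exp_sub_one_le (-y)
      rw [abs_neg] at h1
      have h2 := one_add_abs_exp_sub_one_le y
      have h0 : 0 ≤ 1 + |Real.exp (-y) - 1| := by positivity
      nlinarith
    calc ‖ℓ (A[y] v)‖ ≤ ((1 + |Real.exp (-y) - 1|) * (1 + |Real.exp y - 1|)) ^ N * M := h
      _ ≤ (Real.exp |y| ^ 2) ^ N * M := by gcongr
      _ = M * Real.exp ((2 * N : ℕ) * y) := by rw [abs_of_nonneg hy, Real.exp_nat_mul, pow_mul, mul_comm]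
  have hν : ν ^ 2 + 1 / 4 = (μ₁ ^ 2 + Complex.I * μ₁ * μ₂ - μ₂ ^ 2 / 2 + 2 * μ₁ + m ^ 2 / 2 + μ₁ * m + 2 * m - lam) / 2 -
      (μ₁ + m + 1) ^ 2 / 4 - (μ₁ + m + 1) / 2 := by
    rw [hlam]
    have hI := Complex.I_sq
    linear_combination (μ₂ ^ 2 / 4) * hI
  exact exists_eq_const_mul_exp_mul_besselMode_of_growth (f := fun x : ℝ => ℓ (A[x] v))
    (f₁ := fun x : ℝ => ℓ (A[x] (D Hc v))) (f₂ := fun x : ℝ => ℓ (A[x] (D Hc (D Hc v)))) hf hf₁ ha hIa hode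
    hgrow' ν hν

/-- **… and its Mellin transform**: for `re(S + (μ₁+m+1)/2) > |im ν|`,
`∫₀^∞ ℓ(τ(exp((log u) H)) v) u^{S - 1/2} du/u = c · 2 a^{-(S+μ/2)} 2^{S+μ/2-2} Γ(½(S+μ/2+iν)) Γ(½(S+μ/2-iν))`,
`μ = μ₁ + m + 1` (`integral_cpow_mul_besselMode`); with `S = 2s` two `Γ_ℂ`-factors up to an exponential.
[cite: JacquetLanglands1970, §6] -/
theorem exists_apply_gardingAct_expGLC_eq_besselMode_of_highest_and_mellin (hτb : ∀ g, ‖(τ g : E →L[ℂ] E)‖ ≤ 1)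
    {ℓ : archGardingSpace hcpt τ →ₗ[ℂ] ℂ}
    (hℓ : ∃ (C : ℝ) (𝒮 : Finset (List (Matrix (Fin 2) (Fin 2) (mixedSpace K)))), 0 ≤ C ∧
      ∀ v : archGardingSpace hcpt τ, ‖ℓ v‖ ≤ C * ∑ w ∈ 𝒮, ‖archWordDerivE hcpt τ w v‖)
    {θ₁ θ₂ : ℂ} (hθ₁ : ∀ u : archGardingSpace hcpt τ, ℓ (D (Matrix.single 0 1 𝐜) u) = θ₁ * ℓ u)
    (hθ₂ : ∀ u : archGardingSpace hcpt τ, ℓ (D (Matrix.single 0 1 𝐜I) u) = θ₂ * ℓ u)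
    {a : ℝ} (ha : 0 < a) (hθa : (θ₁ + Complex.I * θ₂) * (θ₁ - Complex.I * θ₂) = -((a : ℂ) ^ 2))
    (μ₁ μ₂ m lam ν : ℂ) (hlam : lam = (μ₁ + Complex.I * μ₂) ^ 2 / 2 - 2 * ν ^ 2 - 2) (v : archGardingSpace hcpt τ)
    (hR : D (Matrix.single 0 1 𝐜 - Matrix.single 1 0 𝐜) v - Complex.I • D (Matrix.single 0 1 𝐜I + Matrix.single 1 0 𝐜I) v = 0)
    (hT : D (Matrix.single 0 0 𝐜I - Matrix.single 1 1 𝐜I) v = (Complex.I * m) • v)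
    (hZ1 : D (Matrix.single 0 0 𝐜 + Matrix.single 1 1 𝐜) v = μ₁ • v)
    (hZ2 : D (Matrix.single 0 0 𝐜I + Matrix.single 1 1 𝐜I) v = μ₂ • v)
    (hC : ∑ i : Fin 2, ∑ j : Fin 2, Da[i,j] (Da[j,i] v) = lam • v) :
    ∃ c : ℂ, (∀ y : ℝ, ℓ (A[y] v) = c * (Real.exp y : ℂ) ^ ((μ₁ + m + 1) / 2) * besselMode a ν (Real.exp y)) ∧
      ∀ S : ℂ, |ν.im| < (S + (μ₁ + m + 1) / 2).re →
        ∫ u in Ioi (0 : ℝ), ℓ (A[Real.log u] v) * (u : ℂ) ^ (S - 1 / 2 - 1) =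
          c * (2 * ((a : ℂ) ^ (-(S + (μ₁ + m + 1) / 2)) * ((2 : ℂ) ^ (S + (μ₁ + m + 1) / 2 - 2) *
            Complex.Gamma ((S + (μ₁ + m + 1) / 2 + Complex.I * ν) / 2) *
              Complex.Gamma ((S + (μ₁ + m + 1) / 2 - Complex.I * ν) / 2)))) := by
  obtain ⟨c, hc⟩ := exists_apply_gardingAct_expGLC_eq_besselMode_of_highest hτ w hτb hℓ hθ₁ hθ₂ ha hθa μ₁ μ₂ m lam ν
    hlam v hR hT hZ1 hZ2 hC
  refine ⟨c, hc, fun S hS => ?_⟩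
  rw [← integral_cpow_mul_besselMode ha hS, ← MeasureTheory.integral_const_mul]
  refine setIntegral_congr_fun measurableSet_Ioi fun u hu => ?_
  rw [hc (Real.log u), Real.exp_log hu]
  ring

end Bessel

end Literature.NumberTheory.Automorphic
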